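import Literature.Analysis.FluidPDE.Tao2016AveragedNS.SelfSimilarCascadeBlowup

/-!
# Tao 2016, §4: admissible eternal solutions of the renormalised lattice WITH COVARIANT VISCOSITY
# — the viscous Liouville / rigidity predicates (LEMMA LAYER, third part)

T. Tao, *Finite time blowup for an averaged three-dimensional Navier–Stokes equation*, J. Amer.
Math. Soc. **29** (2016) 601–674 = arXiv:1402.0290v3 [`Tao2016AveragedNS`]: §4, the viscous
equation displayed before Theorem 4.2 (`∂ₜX_{i,n} = -(1+ε₀)^{2n}X_{i,n} + Σ α (1+ε₀)^{5(n-μ₃)/2} X X`,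
"which generalises the dyadic Katz–Pavlović equation"), Lemma 4.1 (4.8)–(4.10) with the remark
after (4.11) on the dissipation term, Theorem 4.2, and §6.4 (renormalising the dynamics).

This module extends the lemma layer `SelfSimilarCascadeBlowup` (predicates `NoSurvivingEternalFwd`,
`EternalRigidityFwd`, glue `noRobustBlowupBelow_of_eternalFwd`) over the definition module
`RenormalisedCascadeWaves` (`IsEternal`, `EternalSurvivingFwd`, `physWeight`, `bigLam`, `Em`,
`tableQ`/`tableA`/`tableB`).  It was requested by cell harvest/h2-tao-ladder (planner theory-2 g7;
source: the kernel-checked cell line file `d6/K2InfOmega.lean`, sha16 7d4b56fbd03fbec2, second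
half) to make the VISCOUS form of the cell's eternal pair citable by name.  In self-similar
variables `W_n(σ) = Λ^n e^{-σ} X_n(t⋆ - e^{-σ})` around a blow-up time `t⋆` of the `ν`-viscous
lattice, the dissipation term `-ν(1+ε₀)^{2n} X_{i,n}` becomes `-ν(1+ε₀)^{2n} e^{-σ} W_n(σ)`: a
renormalised viscosity that is COVARIANT (not invariant) under shell-shift × log-time translation.
An ω-limit of the renormalised trajectory along base points `(n_k, σ_k) → ∞` therefore solves the
renormalised lattice with viscosity field `ν̂ (1+ε₀)^{2n} e^{-σ}` for some `ν̂ ∈ [0, ∞)`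
(`ν̂ = lim ν (1+ε₀)^{2n_k} e^{-σ_k}`); `ν̂ = 0` is the inviscid eternal solution `IsEternal`.
Everything here is a PREDICATE WITH PARAMETERS or an IMPLICATION between such predicates; nothing
is asserted about any particular table, and NOTHING in this file is a statement about the
Navier–Stokes equations — MODEL lattice ODEs only.  The closed claims of the cell
(`∀ R ≥ 1, NoSurvivingEternalVisc R 1`, `∀ R ≥ 1, EternalRigidityVisc R 1`) are conjectures and
therefore ROUTE ITEMS under `Summits/…`, not declarations of this file.

* `IsEternalVisc ε₀ ν̂ α W` — admissible eternal solution with covariant viscosity `ν̂ ≥ 0`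
  (same admissibility clauses as `IsEternal`); `isEternalVisc_zero_iff`, `IsEternal.isEternalVisc`.
* `NoSurvivingEternalVisc R a` (viscous Liouville: no such solution of an E₂(R) table, for ANY
  `ν̂ ≥ 0`, survives forward at exponent `a`) and `EternalRigidityVisc R a` (Theorem 4.2-level
  blow-up forces one, for SOME `ν̂ ≥ 0`); their `ν̂ = 0` slices are the inviscid predicates
  (`noSurvivingEternalFwd_of_visc`, `eternalRigidityVisc_of_fwd`); monotonicity in `a`;
  the glue `noRobustBlowupBelow_of_eternalVisc`.
* Log-time translation covariance (`IsEternalVisc.translate`, `EternalSurvivingFwd.translate`,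
  `IsEternal.translate`): the amplitude–time scaling of the lattice is log-time translation, maps
  `ν̂ ↦ e^{h} ν̂` and preserves admissibility and forward survival; hence
  `exists_surviving_visc_rescale` (one `ν̂ > 0` with a surviving solution ⇒ every `ν̂' > 0`) and
  `noSurvivingVisc_large_iff_pos` (a "large-viscosity slice" of the Liouville predicate IS the whole
  `ν̂ > 0` statement — negative knowledge for rung design; the invariant parameter is `ν̂²/c`).
-/

open Set MeasureTheory intervalIntegral Filter Topology

namespace Literature.Analysis.FluidPDE

namespace TaoCascade

section ViscousEternal

variable {m : ℕ}

/-- **Admissible eternal solution of the renormalised lattice with covariant renormalised viscosity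
`ν̂ (1+ε₀)^{2n} e^{-σ}`, `ν̂ ≥ 0`**: the shell-wise law of `IsEternal` (damping `1`, feed `Λ`, drain
`Λ⁻¹`) with the extra dissipation term, the same UNIFORM per-shell action bound and the same
per-shell forward bound on the renormalised energy.  `ν̂ = 0` is `IsEternal`
(`isEternalVisc_zero_iff`).
[cite: Tao2016AveragedNS, §4, the viscous equation displayed before Thm. 4.2 and Lemma 4.1 (iii) (4.8), written shell-wise in the self-similar variables of §6.4; cell vocabulary (covariant renormalised viscosity; admissibility clauses are the cell's)] -/
structure IsEternalVisc (ε₀ νh : ℝ) (α : Fin m → Fin m → Fin m → ℤ × ℤ × ℤ → ℝ)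
    (W : ℤ → ℝ → Em m) : Prop where
  law : ∀ (n : ℤ) (σ : ℝ), HasDerivAt (W n)
    (-((1 : ℝ) • W n σ) + tableQ α (W n σ) + bigLam ε₀ • tableA α (W (n - 1) σ)
      + (bigLam ε₀)⁻¹ • tableB α (W (n + 1) σ) (W n σ)
      - (νh * ((1 + ε₀) ^ ((2 : ℝ) * n) * Real.exp (-σ))) • W n σ) σ
  nonneg : 0 ≤ νh
  action : ∃ M : ℝ, ∀ n : ℤ, Integrable (fun σ => ‖W n σ‖) ∧ ∫ σ, ‖W n σ‖ ≤ M
  bdd : ∀ n : ℤ, ∃ σ₀ P : ℝ, ∀ σ, σ₀ ≤ σ → Real.exp (2 * σ) * ‖W n σ‖ ^ 2 ≤ P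

/-- `ν̂ = 0` is the inviscid eternal solution.
[cite: Tao2016AveragedNS, §4 Lemma 4.1 (iii) (4.8); cell vocabulary] -/
theorem isEternalVisc_zero_iff {ε₀ : ℝ} {α : Fin m → Fin m → Fin m → ℤ × ℤ × ℤ → ℝ}
    {W : ℤ → ℝ → Em m} : IsEternalVisc ε₀ 0 α W ↔ IsEternal ε₀ α W := by
  constructor
  · intro h
    refine ⟨fun n σ => ?_, h.action, h.bdd⟩
    simpa only [zero_mul, zero_smul, sub_zero] using h.law n σ
  · intro h
    refine ⟨fun n σ => ?_, le_rfl, h.action, h.bdd⟩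
    simpa only [zero_mul, zero_smul, sub_zero] using h.law n σ

/-- [cite: Tao2016AveragedNS, §4 Lemma 4.1 (iii) (4.8); cell vocabulary] -/
theorem IsEternal.isEternalVisc {ε₀ : ℝ} {α : Fin m → Fin m → Fin m → ℤ × ℤ × ℤ → ℝ}
    {W : ℤ → ℝ → Em m} (h : IsEternal ε₀ α W) : IsEternalVisc ε₀ 0 α W :=
  isEternalVisc_zero_iff.2 h

/-- **K1^∞_visc = `NoSurvivingEternalVisc R a`** (viscous Liouville).  Below a threshold, no E₂(R)
table (`m = 4`) carries an admissible eternal solution with ANY covariant viscosity `ν̂ ≥ 0` that is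
(S_a)-surviving forward.  Its `ν̂ = 0` slice is `NoSurvivingEternalFwd R a`
(`noSurvivingEternalFwd_of_visc`); its `ν̂ > 0` slice excludes dissipation-balanced blow-up
profiles.  A predicate; nothing is asserted.
[cite: Tao2016AveragedNS, §4 Thm. 4.2 (statement shape) and the viscous equation before it, §6.4; cell vocabulary] -/
def NoSurvivingEternalVisc (R a : ℝ) : Prop :=
  ∃ εs : ℝ, 0 < εs ∧ ∀ ε₀ : ℝ, 0 < ε₀ → ε₀ ≤ εs →
    ∀ α : Fin 4 → Fin 4 → Fin 4 → ℤ × ℤ × ℤ → ℝ, InTableClass R α →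
      ∀ (νh : ℝ) (W : ℤ → ℝ → Em 4), IsEternalVisc ε₀ νh α W → ¬ EternalSurvivingFwd a ε₀ W

/-- **K2^∞_visc = `EternalRigidityVisc R a`.**  Below a threshold, Theorem 4.2-level blow-up of an
E₂(R) table from a one-shell datum forces an admissible eternal solution with SOME covariant
viscosity `ν̂ ≥ 0` that survives forward at exponent `a`.  Weaker than `EternalRigidityFwd R a`
(`eternalRigidityVisc_of_fwd`).  A predicate; nothing is asserted.
[cite: Tao2016AveragedNS, §4 Thm. 4.2 (statement shape) and the viscous equation before it, §6.4; cell vocabulary] -/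
def EternalRigidityVisc (R a : ℝ) : Prop :=
  ∃ εs : ℝ, 0 < εs ∧ ∀ ε₀ : ℝ, 0 < ε₀ → ε₀ ≤ εs →
    ∀ (α : Fin 4 → Fin 4 → Fin 4 → ℤ × ℤ × ℤ → ℝ) (X₀ : Fin 4 → ℝ), InTableClass R α →
      NoGlobalCascade ε₀ α X₀ →
        ∃ (νh : ℝ) (W : ℤ → ℝ → Em 4), IsEternalVisc ε₀ νh α W ∧ EternalSurvivingFwd a ε₀ W

/-- The `ν̂ = 0` slice of the viscous Liouville predicate is the inviscid one.
[cite: Tao2016AveragedNS, §4 Thm. 4.2; cell vocabulary] -/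
theorem noSurvivingEternalFwd_of_visc {R a : ℝ} (h : NoSurvivingEternalVisc R a) :
    NoSurvivingEternalFwd R a := by
  obtain ⟨εs, hεs, H⟩ := h
  exact ⟨εs, hεs, fun ε₀ hε₀ hle α hα W hW => H ε₀ hε₀ hle α hα 0 W hW.isEternalVisc⟩

/-- Inviscid rigidity implies viscous rigidity (take `ν̂ = 0`).
[cite: Tao2016AveragedNS, §4 Thm. 4.2; cell vocabulary] -/
theorem eternalRigidityVisc_of_fwd {R a : ℝ} (h : EternalRigidityFwd R a) :
    EternalRigidityVisc R a := by
  obtain ⟨εs, hεs, H⟩ := h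
  refine ⟨εs, hεs, fun ε₀ hε₀ hle α X₀ hα hNG => ?_⟩
  obtain ⟨W, hW, hS⟩ := H ε₀ hε₀ hle α X₀ hα hNG
  exact ⟨0, W, hW.isEternalVisc, hS⟩

/-- K1^∞_visc is antitone in `a`. [cite: Tao2016AveragedNS, §4; cell vocabulary] -/
theorem NoSurvivingEternalVisc.of_le {R a a' : ℝ} (h : NoSurvivingEternalVisc R a') (haa : a ≤ a') :
    NoSurvivingEternalVisc R a := by
  obtain ⟨εs, hεs, H⟩ := h
  exact ⟨εs, hεs, fun ε₀ hε₀ hle α hα νh W hW hS =>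
    H ε₀ hε₀ hle α hα νh W hW (hS.mono hε₀.le haa)⟩

/-- K2^∞_visc is monotone in `a`. [cite: Tao2016AveragedNS, §4; cell vocabulary] -/
theorem EternalRigidityVisc.mono {R a a' : ℝ} (h : EternalRigidityVisc R a) (haa : a ≤ a') :
    EternalRigidityVisc R a' := by
  obtain ⟨εs, hεs, H⟩ := h
  refine ⟨εs, hεs, fun ε₀ hε₀ hle α X₀ hα hNG => ?_⟩
  obtain ⟨νh, W, hW, hS⟩ := H ε₀ hε₀ hle α X₀ hα hNG
  exact ⟨νh, W, hW, hS.mono hε₀.le haa⟩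

/-- **GLUE: `K1^∞_visc ∧ K2^∞_visc ⇒ NoRobustBlowupBelow`** (one spread, one exponent).
[cite: Tao2016AveragedNS, §4 Thm. 4.2; cell vocabulary] -/
theorem noRobustBlowupBelow_of_eternalVisc {R a : ℝ}
    (h1 : NoSurvivingEternalVisc R a) (h2 : EternalRigidityVisc R a) : NoRobustBlowupBelow R := by
  obtain ⟨ε₁, hε₁, H1⟩ := h1
  obtain ⟨ε₂, hε₂, H2⟩ := h2
  refine ⟨min ε₁ ε₂, lt_min hε₁ hε₂, fun ε₀ hε₀ hle α X₀ hα hNG => ?_⟩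
  obtain ⟨νh, W, hW, hS⟩ := H2 ε₀ hε₀ (hle.trans (min_le_right _ _)) α X₀ hα hNG
  exact H1 ε₀ hε₀ (hle.trans (min_le_left _ _)) α hα νh W hW hS

/-- The viscous pair at exponent `a` implies the inviscid-Liouville / viscous-rigidity mixed pair is
NOT needed: spelled out, `NoSurvivingEternalVisc R a` alone already gives `NoSurvivingEternalFwd R a`
and hence K1(a) (`noSurvivingDSS_of_noSurvivingEternalFwd`).
[cite: Tao2016AveragedNS, §4 Thm. 4.2; cell vocabulary] -/
theorem noSurvivingDSS_of_noSurvivingEternalVisc {R a : ℝ} (h : NoSurvivingEternalVisc R a) :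
    NoSurvivingDSS R a :=
  noSurvivingDSS_of_noSurvivingEternalFwd (noSurvivingEternalFwd_of_visc h)

/-- KILL CRITERION for K1^∞_visc: one admissible viscous eternal solution of an E₂(R) table that
survives forward, at every scale ratio below any threshold, refutes it.
[cite: Tao2016AveragedNS, §4 Thm. 4.2; cell vocabulary] -/
theorem not_noSurvivingEternalVisc_of_witnesses {R a : ℝ}
    (h : ∀ εs : ℝ, 0 < εs → ∃ ε₀ : ℝ, 0 < ε₀ ∧ ε₀ ≤ εs ∧
      ∃ (α : Fin 4 → Fin 4 → Fin 4 → ℤ × ℤ × ℤ → ℝ) (νh : ℝ) (W : ℤ → ℝ → Em 4),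
        InTableClass R α ∧ IsEternalVisc ε₀ νh α W ∧ EternalSurvivingFwd a ε₀ W) :
    ¬ NoSurvivingEternalVisc R a := by
  rintro ⟨εs, hεs, H⟩
  obtain ⟨ε₀, hε₀, hle, α, νh, W, hα, hW, hS⟩ := h εs hεs
  exact H ε₀ hε₀ hle α hα νh W hW hS

/-! ### Log-time translation covariance: the viscosity ν̂ is defined only up to scaling

In self-similar variables the amplitude–time scaling `X ↦ λX, t ↦ t/λ` of the lattice is the
log-time TRANSLATION `W ↦ W(· - h)`, `λ = e^{h}`; it maps covariant viscosity `ν̂` to `e^{h} ν̂` and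
preserves admissibility and forward (S_a)-survival.  Consequently the class of `ν̂ > 0` carrying a
surviving admissible eternal solution is invariant under `ν̂ ↦ λν̂` (empty or all of `(0,∞)`), and a
"large-viscosity slice" of the viscous Liouville predicate is the whole `ν̂ > 0` statement — NOT a
cheaper rung (`noSurvivingVisc_large_iff_pos`).  The invariant parameter is `ν̂²/c`, `c` the survival
level (cell map §45). -/

/-- Log-time translation of an admissible viscous eternal solution is one, with viscosity `e^{h} ν̂`.
[cite: Tao2016AveragedNS, §4 (scaling of the cascade ODE; the viscous equation before Thm. 4.2), §6.4; cell vocabulary] -/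
theorem IsEternalVisc.translate {ε₀ νh : ℝ} {α : Fin m → Fin m → Fin m → ℤ × ℤ × ℤ → ℝ}
    {W : ℤ → ℝ → Em m} (hW : IsEternalVisc ε₀ νh α W) (h : ℝ) :
    IsEternalVisc ε₀ (Real.exp h * νh) α (fun n σ => W n (σ - h)) := by
  refine ⟨fun n σ => ?_, mul_nonneg (Real.exp_pos h).le hW.nonneg, ?_, fun n => ?_⟩
  · have hw := (hW.law n (σ - h)).comp_sub_const σ h
    have key : νh * ((1 + ε₀) ^ ((2 : ℝ) * n) * Real.exp (-(σ - h))) =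
        Real.exp h * νh * ((1 + ε₀) ^ ((2 : ℝ) * n) * Real.exp (-σ)) := by
      rw [show -(σ - h) = h + -σ by ring, Real.exp_add]; ring
    rw [key] at hw
    exact hw
  · obtain ⟨M, hM⟩ := hW.action
    refine ⟨M, fun n => ⟨(hM n).1.comp_sub_right h, ?_⟩⟩
    rw [integral_sub_right_eq_self (fun σ => ‖W n σ‖) h]
    exact (hM n).2
  · obtain ⟨σ₀, P, hP⟩ := hW.bdd n
    refine ⟨σ₀ + h, Real.exp (2 * h) * P, fun σ hσ => ?_⟩
    have h1 := hP (σ - h) (by linarith)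
    have hexp : Real.exp (2 * σ) = Real.exp (2 * h) * Real.exp (2 * (σ - h)) := by
      rw [← Real.exp_add]; ring_nf
    rw [hexp, mul_assoc]
    exact mul_le_mul_of_nonneg_left h1 (Real.exp_pos _).le

/-- Log-time translation preserves forward (S_a)-survival.
[cite: Tao2016AveragedNS, §4; cell vocabulary] -/
theorem EternalSurvivingFwd.translate {a ε₀ : ℝ} {W : ℤ → ℝ → Em m}
    (hS : EternalSurvivingFwd a ε₀ W) (h : ℝ) :
    EternalSurvivingFwd a ε₀ (fun n σ => W n (σ - h)) := by
  obtain ⟨c, hc, H⟩ := hS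
  refine ⟨Real.exp (2 * h) * c, mul_pos (Real.exp_pos _) hc, fun N => ?_⟩
  obtain ⟨n, hn, σ', hσ', hle⟩ := H (N + ⌈|h|⌉₊)
  have hceil : |h| ≤ (⌈|h|⌉₊ : ℝ) := Nat.le_ceil _
  have habs : -h ≤ |h| := neg_le_abs h
  refine ⟨n, le_trans (Nat.le_add_right _ _) hn, σ' + h, ?_, ?_⟩
  · have : ((N + ⌈|h|⌉₊ : ℕ) : ℝ) = (N : ℝ) + (⌈|h|⌉₊ : ℝ) := by push_cast; ring
    rw [this] at hσ'
    linarith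
  · have hexp : Real.exp (2 * (σ' + h)) = Real.exp (2 * h) * Real.exp (2 * σ') := by
      rw [← Real.exp_add]; ring_nf
    simp only [add_sub_cancel_right]
    rw [hexp, show physWeight a ε₀ ^ n * (Real.exp (2 * h) * Real.exp (2 * σ') * ‖W n σ'‖ ^ 2) =
      Real.exp (2 * h) * (physWeight a ε₀ ^ n * (Real.exp (2 * σ') * ‖W n σ'‖ ^ 2)) by ring]
    exact mul_le_mul_of_nonneg_left hle (Real.exp_pos _).le

/-- **Viscosity rescaling of surviving solutions**: if some `ν̂ > 0` carries a forward-(S_a)-surviving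
admissible viscous eternal solution of the table `α`, then EVERY `ν̂' > 0` does.
[cite: Tao2016AveragedNS, §4 (scaling), §6.4; cell vocabulary] -/
theorem exists_surviving_visc_rescale {a ε₀ νh νh' : ℝ}
    {α : Fin m → Fin m → Fin m → ℤ × ℤ × ℤ → ℝ} (hν : 0 < νh) (hν' : 0 < νh')
    (hex : ∃ W : ℤ → ℝ → Em m, IsEternalVisc ε₀ νh α W ∧ EternalSurvivingFwd a ε₀ W) :
    ∃ W : ℤ → ℝ → Em m, IsEternalVisc ε₀ νh' α W ∧ EternalSurvivingFwd a ε₀ W := by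
  obtain ⟨W, hW, hS⟩ := hex
  refine ⟨fun n σ => W n (σ - Real.log (νh' / νh)), ?_, hS.translate _⟩
  have key : Real.exp (Real.log (νh' / νh)) * νh = νh' := by
    rw [Real.exp_log (div_pos hν' hν), div_mul_cancel₀ _ hν.ne']
  simpa only [key] using hW.translate (Real.log (νh' / νh))

/-- **A "large-viscosity slice" is the whole positive-viscosity Liouville statement** (for a fixed
table, scale ratio and exponent): excluding surviving admissible viscous eternal solutions for all
`ν̂ ≥ ν̂₀` (any `ν̂₀`) is equivalent to excluding them for all `ν̂ > 0`.
[cite: Tao2016AveragedNS, §4 (scaling), §6.4; cell vocabulary (negative knowledge for rung design)] -/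
theorem noSurvivingVisc_large_iff_pos {a ε₀ ν₀ : ℝ} {α : Fin m → Fin m → Fin m → ℤ × ℤ × ℤ → ℝ}
    (hν₀ : 0 < ν₀) :
    (∀ νh : ℝ, ν₀ ≤ νh → ∀ W : ℤ → ℝ → Em m, IsEternalVisc ε₀ νh α W → ¬ EternalSurvivingFwd a ε₀ W) ↔
    (∀ νh : ℝ, 0 < νh → ∀ W : ℤ → ℝ → Em m, IsEternalVisc ε₀ νh α W → ¬ EternalSurvivingFwd a ε₀ W) := by
  constructor
  · intro H νh hνh W hW hS
    obtain ⟨W', hW', hS'⟩ := exists_surviving_visc_rescale (a := a) hνh hν₀ ⟨W, hW, hS⟩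
    exact H ν₀ le_rfl W' hW' hS'
  · intro H νh hνh W hW hS
    exact H νh (lt_of_lt_of_le hν₀ hνh) W hW hS

/-- The inviscid class is translation-invariant too (`ν̂ = 0 ↦ 0`).
[cite: Tao2016AveragedNS, §4, §6.4; cell vocabulary] -/
theorem IsEternal.translate {ε₀ : ℝ} {α : Fin m → Fin m → Fin m → ℤ × ℤ × ℤ → ℝ}
    {W : ℤ → ℝ → Em m} (hW : IsEternal ε₀ α W) (h : ℝ) :
    IsEternal ε₀ α (fun n σ => W n (σ - h)) := by
  have := hW.isEternalVisc.translate h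
  rw [mul_zero] at this
  exact isEternalVisc_zero_iff.1 this

end ViscousEternal

end TaoCascade

end Literature.Analysis.FluidPDE
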